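import Literature.NumberTheory.Weil1964.ArchMetaplecticLeviCover
import Literature.NumberTheory.Weil1964.ArchTwistedDiagonalLevi
import HarnessLib

/-!
# The metaplectic double cover splits over the twisted diagonal `Sp(W) → Sp(W ⊕ W)`, `T ↦ T ⊕ cTc` (given R1, R2)

Topic `NumberTheory/Weil1964`; namespace `Literature.NumberTheory.Weil1964.MpS`.  Assembly of
`Literature.NumberTheory.Weil1964.ArchTwistedDiagonalLevi` (the twisted diagonal `T ↦ T ⊕ cTc` of weil-1's `Sp(W)` in
`Sp(W ⊕ W)` is `beamSplitter`-conjugate to the Siegel Levi element `m(leviA T, leviD T)` with `det (leviA T) = 1`) with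
`Literature.NumberTheory.Weil1964.ArchMetaplecticLeviCover` (given the record R1 `Folland1989_Thm_4_37_ab`, the geometric
Levi section `leviHomPos : GL⁺ →* Mp^𝓢` takes metaplectic values) and
`Literature.NumberTheory.Weil1964.ArchMetaplecticNormality` (`IsMetaplectic.conj_of`: Folland's normalisation is
stable under conjugation by any implementer, given R1 and R2 `Folland1989_Thm_4_37_c`).

RESULT (kernel; R1, R2 as explicit hypotheses only where used): for any implementer `y ∈ Mp^𝓢(W ⊕ W)` of the beam
splitter (one exists unconditionally, `exists_proj_eq_beamSplitter`), the map
`doublingSection y : Sp(W) →* Mp^𝓢(W ⊕ W)`, `T ↦ y · levi (leviA T) (leviD T) · y⁻¹`, is a HOMOMORPHISM lying over the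
twisted diagonal (`proj_doublingSection : proj (doublingSection y T) = T ⊕ cTc`) all of whose values are metaplectic
(`isMetaplectic_doublingSection`, given R1 ∧ R2): **the metaplectic double cover `Mp₂(W ⊕ W) → Sp(W ⊕ W)` restricted to
the twisted diagonal — equivalently to the diagonal `Sp(W)` of the doubled space `Sp(W ⊕ W⁻)` — SPLITS, by an explicit
homomorphic section**, and the two metaplectic elements over `T ⊕ cTc` are `± doublingSection y T`
(`IsMetaplectic.eq_doublingSection_or`).  This is the archimedean, Schwartz-model form of the splitting of the
metaplectic cover over the doubling diagonal [GelbartPiatetskishapiroRallis1987, Part A §1; Kudla1994, §§1–3] and the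
hyperbolic-plane step of the pub-hodgecm2 literature fan-out row B08-2 (b) [Paul1998, (1.2.1)]: for the dual pair
`(U(V), U(W'))` and a hyperbolic plane `H ⊂ W'`, `ι_V(g)|_{V ⊗ H} = T_g ⊕ cT_gc`, so the metaplectic 2-cocycle of `U(V)`
is a coboundary (indeed trivial in Folland's normalisation) on `V ⊗ H`.

## References

* [GelbartPiatetskishapiroRallis1987] S. Gelbart, I. Piatetski-Shapiro, S. Rallis, *Explicit constructions of
  automorphic L-functions*, LNM 1254 (1987), Part A §1.
* [Kudla1994] S. Kudla, *Splitting metaplectic covers of dual reductive pairs*, Israel J. Math. 87 (1994) 361–401, §§1–3.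
* [Folland1989] G. B. Folland, *Harmonic Analysis in Phase Space*, Princeton UP 1989, §4.2 (4.24), Thm. (4.37).
* [Paul1998] A. Paul, *Howe correspondence for real unitary groups*, J. Funct. Anal. 159 (1998), §1.2 (1.2.1).
-/

set_option autoImplicit false

noncomputable section

open Matrix

namespace Literature.NumberTheory.Weil1964

open Literature.Analysis.SegalBargmann Literature.RepresentationTheory.HeisenbergGroup

variable {σ : Type*} [Fintype σ] [DecidableEq σ]

local notation "PV" σ => (σ → ℝ) × (σ → ℝ)
local notation "SpR" σ => symplecticGroup (polar (dotPairing σ))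

namespace MpS

/-- The Levi data `(leviA T, leviD T)` of `T ∈ Sp(W)` as an element of the positive Levi pairs of `W ⊕ W`
(`det (leviA T) = 1 > 0`). [cite: GelbartPiatetskishapiroRallis1987, Part A §1] -/
def dblLeviPair (T : SpR σ) : leviPairsPos (σ ⊕ σ) :=
  ⟨(Sp.leviA T, Sp.leviD T), ⟨Sp.leviA_had T, Sp.det_leviA_pos T⟩⟩

/-- Unfolding. [cite: GelbartPiatetskishapiroRallis1987, Part A §1] -/
@[simp] theorem coe_dblLeviPair (T : SpR σ) :
    ((dblLeviPair T : leviPairsPos (σ ⊕ σ)) : ((σ ⊕ σ → ℝ) ≃ₗ[ℝ] (σ ⊕ σ → ℝ)) × ((σ ⊕ σ → ℝ) ≃ₗ[ℝ] (σ ⊕ σ → ℝ))) =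
      (Sp.leviA T, Sp.leviD T) := rfl

variable (σ) in
/-- `T ↦ (leviA T, leviD T)` is a homomorphism `Sp(W) →* GL⁺`-pairs of `W ⊕ W`. [cite: GelbartPiatetskishapiroRallis1987, Part A §1] -/
def dblLeviPairHom : (SpR σ) →* leviPairsPos (σ ⊕ σ) where
  toFun := dblLeviPair
  map_one' := Subtype.ext (Prod.ext Sp.leviA_one Sp.leviD_one)
  map_mul' T T' := Subtype.ext (Prod.ext (Sp.leviA_mul T T') (Sp.leviD_mul T T'))

/-- Unfolding. [cite: GelbartPiatetskishapiroRallis1987, Part A §1] -/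
@[simp] theorem dblLeviPairHom_apply (T : SpR σ) : dblLeviPairHom σ T = dblLeviPair T := rfl

/-- **The doubling section** `T ↦ y · levi (leviA T) (leviD T) · y⁻¹ : Sp(W) →* Mp^𝓢(W ⊕ W)`, for an implementer `y` of
the beam splitter: a HOMOMORPHISM (conjugate of the geometric Levi section composed with `T ↦ (leviA T, leviD T)`).
[cite: GelbartPiatetskishapiroRallis1987, Part A §1; Kudla1994, §3] -/
def doublingSection (y : MpS (σ ⊕ σ)) : (SpR σ) →* MpS (σ ⊕ σ) :=
  (MulAut.conj y).toMonoidHom.comp ((leviHomPos (σ ⊕ σ)).comp (dblLeviPairHom σ))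

/-- Unfolding: `doublingSection y T = y · levi (leviA T) (leviD T) · y⁻¹`. [cite: GelbartPiatetskishapiroRallis1987, Part A §1] -/
theorem doublingSection_apply (y : MpS (σ ⊕ σ)) (T : SpR σ) :
    doublingSection y T = y * levi (Sp.leviA T) (Sp.leviD T) (Sp.leviA_had T) * y⁻¹ := rfl

/-- **The doubling section lies over the twisted diagonal**: `proj (doublingSection y T) = T ⊕ cTc` when `y` implements
the beam splitter. [cite: GelbartPiatetskishapiroRallis1987, Part A §1; Li1992, p. 181] -/
theorem proj_doublingSection {y : MpS (σ ⊕ σ)} (hy : proj y = Sp.beamSplitter σ) (T : SpR σ) :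
    proj (doublingSection y T) = spBlock (T, Sp.conjSp σ T) := by
  rw [doublingSection_apply, map_mul, map_mul, map_inv, hy, proj_levi, Sp.spBlock_conjSp_eq]

/-- **Its values are metaplectic** (given R1, R2): `levi (leviA T) (leviD T)` is normalised because `det (leviA T) = 1 >
0` (`isMetaplectic_leviHomPos`), and normalisation survives conjugation by `y` (`IsMetaplectic.conj_of`). So the
metaplectic double cover SPLITS over the twisted diagonal `{T ⊕ cTc}` by the homomorphism `doublingSection y`.
[cite: Kudla1994, §§1–3; Folland1989, Thm. (4.37)] -/
theorem isMetaplectic_doublingSection (h1 : Folland1989_Thm_4_37_ab (σ ⊕ σ)) (h2 : Folland1989_Thm_4_37_c (σ ⊕ σ))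
    (y : MpS (σ ⊕ σ)) (T : SpR σ) : IsMetaplectic (doublingSection y T) := by
  rw [doublingSection_apply]
  exact (isMetaplectic_leviHomPos h1 (dblLeviPair T)).conj_of h1 h2 y

/-- An implementer of the beam splitter exists (unconditionally: `Mp^𝓢 → Sp` is onto). [cite: Folland1989, §4.2 (4.23), Prop. (4.27)] -/
theorem exists_proj_eq_beamSplitter : ∃ y : MpS (σ ⊕ σ), proj y = Sp.beamSplitter σ := proj_surjective _

/-- **The fibre over the twisted diagonal**: given R1, R2 and an implementer `y` of the beam splitter, the metaplectic
elements over `T ⊕ cTc` are exactly `± doublingSection y T`. [cite: Folland1989, Thm. (4.37); Kudla1994, §3] -/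
theorem IsMetaplectic.eq_doublingSection_or (h1 : Folland1989_Thm_4_37_ab (σ ⊕ σ))
    (h2 : Folland1989_Thm_4_37_c (σ ⊕ σ)) {y : MpS (σ ⊕ σ)} (hy : proj y = Sp.beamSplitter σ) {x : MpS (σ ⊕ σ)}
    (hx : IsMetaplectic x) (T : SpR σ) (hproj : proj x = spBlock (T, Sp.conjSp σ T)) :
    x = doublingSection y T ∨ x = negOne * doublingSection y T :=
  (isMetaplectic_doublingSection h1 h2 y T).eq_or_eq_negOne_mul hx (by rw [proj_doublingSection hy, hproj])

/-- **Splitting over the twisted diagonal, packaged** (given R1, R2): there is a homomorphism `s : Sp(W) →* Mp^𝓢(W ⊕ W)`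
over `T ↦ T ⊕ cTc` with metaplectic values. [cite: Kudla1994, §§1–3; GelbartPiatetskishapiroRallis1987, Part A §1] -/
theorem exists_metaplectic_section_twistedDiagonal (h1 : Folland1989_Thm_4_37_ab (σ ⊕ σ))
    (h2 : Folland1989_Thm_4_37_c (σ ⊕ σ)) :
    ∃ s : (SpR σ) →* MpS (σ ⊕ σ), ∀ T, proj (s T) = spBlock (T, Sp.conjSp σ T) ∧ IsMetaplectic (s T) := by
  obtain ⟨y, hy⟩ := exists_proj_eq_beamSplitter (σ := σ)
  exact ⟨doublingSection y, fun T => ⟨proj_doublingSection hy T, isMetaplectic_doublingSection h1 h2 y T⟩⟩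

end MpS

end Literature.NumberTheory.Weil1964

end
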